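import Summits.CriticalPhenomena.PercolationContinuityZ3.Theorems.PercNearOneGluingNoHeavyLowerTailSahiCombTriWAndQ311Cols
import Summits.CriticalPhenomena.PercolationContinuityZ3.Theorems.PercNearOneGluingNoHeavyLowerTailSahiCombTriWAndClawPlus

/-!
# AND with the block `Q(3,1,1) = maj₃(x₀, x₁, z₂z₃z₄)`, part 3: `P₁ ∧ Q(3,1,1)` is an intersecting Kleitman shell whenever `P₁` is

Support file of the one-cut programme (crux `NoHeavyLowerTail`, stmt-CriticalPhenomena-4575; unit `prim-lf-1` gen 58, memo
`FROM-prim-lf-1-gen57-PERFECT4.md` §7).  `q311 = maj₃(x₀, x₁, z₂z₃z₄) ⊆ 2^{Fin 5}` is the AND-substituted claw `Q(3,1,1)`: the block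
`R[c := z₂z₃z₄]` for `R = maj₃`, i.e. the first instance of the SUBSTITUTION CONJECTURE (gen 51) with a substituted AND of three variables,
for which no symbol-cone certificate exists (gens 49–53).  The five-term certificate used here was found by the complete support-mode
local-certificate LP of gen 57 (1 409 monotone support configurations, max-flow pricing of unit words) and verified there in exact arithmetic
(kit j234040 / j234064); in the normalisation of this file it reads
`2·Σ_{y∈Q} δ_A δ_B ≥ S₁S₁' + S₂S₂' + S₃S₃' + V W' + W V'` pointwise (notation of part 2).
* `corP_andProd_q311_eq`: row decomposition `Cor_{P₁ ∧ q311}(A,B) = Σ_{x∈P₁}[uu' + hh' + aa' + bb' + Σ_i t_it'_i + Σ_i o_io'_i]`;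
* **`corP_andProd_q311_nonneg`**: `Cor_{P₁ ∧ q311}(A,B) ≥ 0` for every antipode-free up-set `P₁` with `Cor_{P₁} ≥ 0` and all up-sets
  `A, B` of `2^{γ₁ ⊕ Fin 5}`; `…_of_klShell`; **`klShell_andProd_q311`**: the AND-product is an intersecting Kleitman shell.
Proof: pointwise, `rearr3` (part `…AndMaj3Cols`) bounds `Σ_i o_io'_i`, `Σ_i t_it'_i` below by the anti-aligned products of the sorted profiles and
`rearr_two` (from `…AndClawPlus`) bounds `aa' + bb'`; the Profile Lemma (part 1) bounds twice that below by `S₁S₁' + S₂S₂' + S₃S₃' + VW' + WV'`; the five words are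
increasing with the pair condition and values in `[-2,2]` (part 2), so `sum_mul_nonneg_of_two` (goodness of `P₁`) makes every summed product
non-negative.
HONEST LABEL: complete proof, standard axioms.  Closes the `Q(3,1,1)` case of `AndShellLower` (intersecting half); second block theorem obtained
from a machine-found local certificate (after perfect4). [this work]
-/

namespace Summit.CriticalPhenomena.PercolationContinuityZ3.Theorems

namespace FiveUpSet

open Finset Q311Cert

variable {γ₁ : Type} [DecidableEq γ₁] [Fintype γ₁]

/-! ### Row decomposition and the theorem -/


/-- **Row decomposition**: `Cor_{P₁ ∧ q311}(A,B) = Σ_{x∈P₁}[uu' + hh' + aa' + bb' + Σ_i t_it'_i + Σ_i o_io'_i]`. [this work] -/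
theorem corP_andProd_q311_eq (P₁ : Finset (Finset γ₁)) (A B : Finset (Finset (γ₁ ⊕ Fin 5))) :
    corP (andProd P₁ q311) A B = ∑ x ∈ P₁, (qU A x * qU B x + qH A x * qH B x + qA A x * qA B x + qB A x * qB B x
      + ∑ i : Fin 3, qT A i x * qT B i x + ∑ i : Fin 3, qO A i x * qO B i x) := by
  rw [corP_eq_sum, andProd_eq_biUnion, sum_biUnion (pairwiseDisjoint_rows P₁ q311)]
  refine sum_congr rfl fun x _ => ?_
  rw [sum_map, sum_q311]
  unfold qU qH qA qB qT qO bcol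
  simp only [rowEmb_apply]

/-- **THEOREM (AND with the block `Q(3,1,1) = maj₃(x₀,x₁,z₂z₃z₄)`).**  If `P₁` is an antipode-free up-set with `Cor_{P₁} ≥ 0` on all pairs of
up-sets, then `Cor_{P₁ ∧ q311}(A,B) ≥ 0` for all up-sets `A, B` of the product cube `2^{γ₁ ⊕ Fin 5}`. [this work] -/
theorem corP_andProd_q311_nonneg {P₁ : Finset (Finset γ₁)} (hP : IsUpperSet (P₁ : Set (Finset γ₁))) (hd : Disjoint P₁ (refl P₁))
    (hcor : ∀ U V : Finset (Finset γ₁), IsUpperSet (U : Set (Finset γ₁)) → IsUpperSet (V : Set (Finset γ₁)) → 0 ≤ corP P₁ U V)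
    {A B : Finset (Finset (γ₁ ⊕ Fin 5))} (hA : IsUpperSet (A : Set (Finset (γ₁ ⊕ Fin 5)))) (hB : IsUpperSet (B : Set (Finset (γ₁ ⊕ Fin 5)))) :
    0 ≤ corP (andProd P₁ q311) A B := by
  rw [corP_andProd_q311_eq]
  -- pointwise: rearrangement on the two triples and the pair + the Profile Lemma (part 1)
  have key : ∀ x ∈ P₁, qS1 A x * qS1 B x + qS2 A x * qS2 B x + qS3 A x * qS3 B x + qV A x * qW B x + qW A x * qV B x
      ≤ 2 * (qU A x * qU B x + qH A x * qH B x + qA A x * qA B x + qB A x * qB B x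
        + ∑ i : Fin 3, qT A i x * qT B i x + ∑ i : Fin 3, qO A i x * qO B i x) := by
    intro x _
    obtain ⟨uA, hhA, aA, bA, hiA⟩ := qcols_bounds (A := A) x
    obtain ⟨uB, hhB, aB, bB, hiB⟩ := qcols_bounds (A := B) x
    have hA0 := hiA 0; have hA1 := hiA 1; have hA2 := hiA 2; have hB0 := hiB 0; have hB1 := hiB 1; have hB2 := hiB 2
    have hrO : oMin A x * oMax B x + oMed A x * oMed B x + oMax A x * oMin B x
        ≤ qO A 0 x * qO B 0 x + qO A 1 x * qO B 1 x + qO A 2 x * qO B 2 x := by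
      unfold oMed oMin oMax
      exact rearr3 _ _ _ _ _ _ hA0.1.1 hA0.1.2 hA1.1.1 hA1.1.2 hA2.1.1 hA2.1.2
    have hrT : qtMin A x * qtMax B x + qtMed A x * qtMed B x + qtMax A x * qtMin B x
        ≤ qT A 0 x * qT B 0 x + qT A 1 x * qT B 1 x + qT A 2 x * qT B 2 x := by
      unfold qtMed qtMin qtMax
      exact rearr3 _ _ _ _ _ _ hA0.2.1 hA0.2.2 hA1.2.1 hA1.2.2 hA2.2.1 hA2.2.2
    have hrP : aLo A x * aHi B x + aHi A x * aLo B x ≤ qA A x * qA B x + qB A x * qB B x := by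
      unfold aLo aHi; exact rearr_two _ _ _ _
    obtain ⟨aom, aod, aoM, atm, atd, atM, al, ah⟩ := qstats_bounds (A := A) x
    obtain ⟨bom, bod, boM, btm, btd, btM, bl, bh⟩ := qstats_bounds (A := B) x
    obtain ⟨as1, as2, as3, as4, as5⟩ := qstats_sorted (A := A) x
    obtain ⟨bs1, bs2, bs3, bs4, bs5⟩ := qstats_sorted (A := B) x
    obtain ⟨ao1, ao2, ao3, ao4, ao5⟩ := qstats_order hA x
    obtain ⟨bo1, bo2, bo3, bo4, bo5⟩ := qstats_order hB x
    have tri : ∀ z : ℤ, -1 ≤ z ∧ z ≤ 1 → z = -1 ∨ z = 0 ∨ z = 1 := fun z hz => by omega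
    have hprof := profile_ineq (tri _ uA) (tri _ hhA) (tri _ aom) (tri _ aod) (tri _ aoM) (tri _ atm) (tri _ atd) (tri _ atM)
      (tri _ al) (tri _ ah) (tri _ uB) (tri _ hhB) (tri _ bom) (tri _ bod) (tri _ boM) (tri _ btm) (tri _ btd) (tri _ btM)
      (tri _ bl) (tri _ bh)
      as1 as2 as3 as4 as5 ao1 ao2 ao3 ao4 ao5 bs1 bs2 bs3 bs4 bs5 bo1 bo2 bo3 bo4 bo5
    simp only [rhs, lhs2] at hprof
    unfold qS1 qS2 qS3 qV qW
    rw [Fin.sum_univ_three, Fin.sum_univ_three]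
    linarith [hprof, hrO, hrT, hrP]
  have hsum := sum_le_sum key
  rw [← mul_sum] at hsum
  have eqL : ∑ x ∈ P₁, (qS1 A x * qS1 B x + qS2 A x * qS2 B x + qS3 A x * qS3 B x + qV A x * qW B x + qW A x * qV B x)
      = ∑ x ∈ P₁, qS1 A x * qS1 B x + ∑ x ∈ P₁, qS2 A x * qS2 B x + ∑ x ∈ P₁, qS3 A x * qS3 B x
        + ∑ x ∈ P₁, qV A x * qW B x + ∑ x ∈ P₁, qW A x * qV B x := by
    simp only [sum_add_distrib]
  rw [eqL] at hsum
  have bwA := fun x : Finset γ₁ => qwords_bounds (A := A) x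
  have bwB := fun x : Finset γ₁ => qwords_bounds (A := B) x
  have t11 := sum_mul_nonneg_of_two hP hd hcor (qS1 A) (qS1 B) (fun x _ => (bwA x).1) (fun x _ => (bwB x).1)
    (fun x _ x' _ h => (qwords_mono hA h).1) (fun x _ x' _ h => (qwords_mono hB h).1)
    (fun x _ x' _ h => (qwords_pair hA h).1) (fun x _ x' _ h => (qwords_pair hB h).1)
  have t22 := sum_mul_nonneg_of_two hP hd hcor (qS2 A) (qS2 B) (fun x _ => (bwA x).2.1) (fun x _ => (bwB x).2.1)
    (fun x _ x' _ h => (qwords_mono hA h).2.1) (fun x _ x' _ h => (qwords_mono hB h).2.1)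
    (fun x _ x' _ h => (qwords_pair hA h).2.1) (fun x _ x' _ h => (qwords_pair hB h).2.1)
  have t33 := sum_mul_nonneg_of_two hP hd hcor (qS3 A) (qS3 B) (fun x _ => (bwA x).2.2.1) (fun x _ => (bwB x).2.2.1)
    (fun x _ x' _ h => (qwords_mono hA h).2.2.1) (fun x _ x' _ h => (qwords_mono hB h).2.2.1)
    (fun x _ x' _ h => (qwords_pair hA h).2.2.1) (fun x _ x' _ h => (qwords_pair hB h).2.2.1)
  have tVW := sum_mul_nonneg_of_two hP hd hcor (qV A) (qW B) (fun x _ => (bwA x).2.2.2.1) (fun x _ => (bwB x).2.2.2.2)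
    (fun x _ x' _ h => (qwords_mono hA h).2.2.2.1) (fun x _ x' _ h => (qwords_mono hB h).2.2.2.2)
    (fun x _ x' _ h => (qwords_pair hA h).2.2.2.1) (fun x _ x' _ h => (qwords_pair hB h).2.2.2.2)
  have tWV := sum_mul_nonneg_of_two hP hd hcor (qW A) (qV B) (fun x _ => (bwA x).2.2.2.2) (fun x _ => (bwB x).2.2.2.1)
    (fun x _ x' _ h => (qwords_mono hA h).2.2.2.2) (fun x _ x' _ h => (qwords_mono hB h).2.2.2.1)
    (fun x _ x' _ h => (qwords_pair hA h).2.2.2.2) (fun x _ x' _ h => (qwords_pair hB h).2.2.2.1)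
  linarith

/-- The same theorem with the hypothesis in Kleitman-shell form. [this work] -/
theorem corP_andProd_q311_nonneg_of_klShell {P₁ : Finset (Finset γ₁)} (hP : IsUpperSet (P₁ : Set (Finset γ₁)))
    (hd : Disjoint P₁ (refl P₁)) (hs : KlShell (P₁ ∪ refl P₁))
    {A B : Finset (Finset (γ₁ ⊕ Fin 5))} (hA : IsUpperSet (A : Set (Finset (γ₁ ⊕ Fin 5)))) (hB : IsUpperSet (B : Set (Finset (γ₁ ⊕ Fin 5)))) :
    0 ≤ corP (andProd P₁ q311) A B :=
  corP_andProd_q311_nonneg hP hd (fun U V hU hV => by rw [corP_eq_card_sub_card_of_disjoint hd]; exact hs U V hU hV) hA hB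

/-- **`P₁ ∧ Q(3,1,1)` is an intersecting Kleitman shell** whenever `P₁` is (with `Cor_{P₁} ≥ 0`). [this work] -/
theorem klShell_andProd_q311 {P₁ : Finset (Finset γ₁)} (hP : IsUpperSet (P₁ : Set (Finset γ₁))) (hd : Disjoint P₁ (refl P₁))
    (hcor : ∀ U V : Finset (Finset γ₁), IsUpperSet (U : Set (Finset γ₁)) → IsUpperSet (V : Set (Finset γ₁)) → 0 ≤ corP P₁ U V) :
    KlShell (andProd P₁ q311 ∪ refl (andProd P₁ q311)) :=
  klShell_of_corP_nonneg (disjoint_andProd_refl hd q311) fun _ _ hA hB => corP_andProd_q311_nonneg hP hd hcor hA hB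

end FiveUpSet

end Summit.CriticalPhenomena.PercolationContinuityZ3.Theorems
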